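import Literature.Computability.Complexity.CliqueTestGraphs
import Literature.Computability.Complexity.NegationElimination
import HarnessLib

/-!
# Restrictions of circuits for CLIQUE and clique-like functions (Amano–Maruoka, Jukna §9.8)

Circuit-side infrastructure for the Amano–Maruoka lower bound (`AmanoMaruoka.lean`,
`AmanoMaruokaProofs.lean`): the negation gates of a `{∧₂, ∨₂, ¬}`-circuit for `CLIQUE(m, s)`
are eliminated one at a time by *restrictions* — all edges outside a set `V` of live vertices
are frozen to constants — chosen so that the monotone function feeding the first NOT gate
becomes constant, while the restricted function stays *clique-like* on `V` in the sense of
Jukna (2012, §9.8): monotone, rejecting all `a`-cocliques (complete `a`-partite graphs) and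
accepting all `b`-cliques. Everything in this file is PROVED.

* `IsLive V e`, `select V π x` (live edges from `x`, dead edges from the pattern `π`),
  `colorTest V h` (the `a`-coclique of the colouring `h` on the live edges, dead edges on) and
  the elementary pointwise comparisons between these test inputs;
* `CliqueLike V a b F` — Jukna's `(a, b)`-clique functions relative to the live set `V`
  (Jukna 2012, §9.8, p. 269), with `cliqueLike_cliqueFn` (CLIQUE(m,s) is `(s-1, s)`-clique-like),
  and its behaviour under the two restrictions: `CliqueLike.restrictColor` (live set shrinks to a
  monochromatic `W`, pattern = a coclique: `(a, b) ↦ (a - c, b)`) and `CliqueLike.restrictClique`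
  (live set shrinks to `Q`, pattern = all-zero: `(a, b)` unchanged);
* `apply_select_colorTest_eq_true`, `apply_select_bot_eq_false` — after these restrictions a monotone
  `g` with `g (colorTest V h) = 1`, resp. `g (cliqueVec Q) = 0`, becomes the constant `1`,
  resp. `0` (Jukna 2012, §10.5, proof of Claim 10.22: "as the function `g` is monotone, in both
  cases it turns into a constant function, and the subsequent NOT gate can be eliminated");
* `GateList.restrictGates` — the restricted straight-line program (two constant gates followed
  by the relocated program, `CircuitComposition.reloc`), its values (`vals_restrictGates`),
  well-formedness, basis, NOT count and length; `GateList.killFirstNot` — restricting a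
  program `pre ++ ¬w :: post` whose wire `w` is constant after restriction and freezing the NOT
  gate to a constant: two more gates, one NOT gate fewer, computing `F ∘ select`.

## References

* S. Jukna, *Boolean Function Complexity: Advances and Frontiers*, Springer (2012), §9.8
  (p. 269, `(a,b)`-clique functions) and §10.5 (Theorem 10.21, proof of Claim 10.22, p. 297) [Jukna2012].
* K. Amano, A. Maruoka, *A superpolynomial lower bound for a circuit computing the clique
  function with at most (1/6) log log n negation gates*, SIAM J. Comput. 35 (2005) 201–216
  [AmanoMaruoka2005].
-/

namespace Literature.Computability.Complexity

open Finset GateList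

variable {m : ℕ}

/-! ### Edges of the complete graph -/

/-- Induction on edges of `K_m` through ordered pairs of distinct vertices. [folklore] -/
theorem edge_ind {P : (⊤ : SimpleGraph (Fin m)).edgeSet → Prop}
    (h : ∀ (u v : Fin m) (huv : u ≠ v), P ⟨s(u, v), (SimpleGraph.mem_edgeSet _).2 huv⟩) :
    ∀ e, P e := by
  rintro ⟨e, he⟩
  induction e using Sym2.ind with
  | _ u v => exact h u v ((SimpleGraph.mem_edgeSet _).1 he)

/-- Edges of `K_m` are not loops. [folklore] -/
theorem not_isDiag_edge (e : (⊤ : SimpleGraph (Fin m)).edgeSet) : ¬ (e : Sym2 (Fin m)).IsDiag :=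
  SimpleGraph.not_isDiag_of_mem_edgeSet _ e.2

/-! ### Live edges, selections and test inputs -/

/-- An edge is *live* for the vertex set `V` if both endpoints lie in `V`. [folklore] -/
def IsLive (V : Finset (Fin m)) (e : (⊤ : SimpleGraph (Fin m)).edgeSet) : Prop :=
  ∀ v ∈ (e : Sym2 (Fin m)), v ∈ V

/-- Liveness is decidable (a finite conjunction of memberships). [folklore] -/
instance (V : Finset (Fin m)) (e : (⊤ : SimpleGraph (Fin m)).edgeSet) : Decidable (IsLive V e) := by
  unfold IsLive; infer_instance

/-- Liveness of a concrete edge. [folklore] -/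
theorem isLive_mk {V : Finset (Fin m)} {u v : Fin m} (he : s(u, v) ∈ (⊤ : SimpleGraph (Fin m)).edgeSet) :
    IsLive V ⟨s(u, v), he⟩ ↔ u ∈ V ∧ v ∈ V := by
  simp [IsLive]

/-- Boolean comparison through the false values. [folklore] -/
theorem bool_le_of_eq_false {x y : Bool} (h : y = false → x = false) : x ≤ y := by
  cases x <;> cases y <;> simp_all

/-- Liveness is monotone in the vertex set. [folklore] -/
theorem IsLive.mono {V W : Finset (Fin m)} (hVW : W ⊆ V) {e : (⊤ : SimpleGraph (Fin m)).edgeSet}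
    (h : IsLive W e) : IsLive V e := fun v hv => hVW (h v hv)

/-- The **restriction map** of a live set `V` and a pattern `π`: live edges are read from the
input `x`, dead edges from `π` (Jukna 2012, §10.5, proof of Claim 10.22: assigning constants to
a set of variables). [cite: Jukna2012, §10.5] -/
def select (V : Finset (Fin m)) (π x : (⊤ : SimpleGraph (Fin m)).edgeSet → Bool) :
    (⊤ : SimpleGraph (Fin m)).edgeSet → Bool :=
  fun e => if IsLive V e then x e else π e

/-- `select` on a live edge. [folklore] -/
theorem select_of_isLive {V : Finset (Fin m)} {π x : (⊤ : SimpleGraph (Fin m)).edgeSet → Bool}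
    {e : (⊤ : SimpleGraph (Fin m)).edgeSet} (h : IsLive V e) : select V π x e = x e := if_pos h

/-- `select` on a dead edge. [folklore] -/
theorem select_of_not_isLive {V : Finset (Fin m)} {π x : (⊤ : SimpleGraph (Fin m)).edgeSet → Bool}
    {e : (⊤ : SimpleGraph (Fin m)).edgeSet} (h : ¬ IsLive V e) : select V π x e = π e := if_neg h

/-- `select` is monotone in the input. [folklore] -/
theorem select_mono (V : Finset (Fin m)) (π : (⊤ : SimpleGraph (Fin m)).edgeSet → Bool) :
    Monotone (select V π) := fun x y hxy e => by
  unfold select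
  split
  · exact hxy e
  · exact le_rfl

/-- The **coclique test input** of a colouring `h` relative to the live set `V`: a live edge is
on iff its endpoints have different colours (the complete `c`-partite graph of `h` on `V`,
Jukna 2012, §9.8, "`a`-cocliques"); dead edges are on (they only matter for evaluating CNF
clauses, which are then satisfied for free). For `V = univ` this is `colorVec h`
(`colorTest_univ`). [cite: Jukna2012, §9.8] -/
def colorTest (V : Finset (Fin m)) {c : ℕ} (h : Fin m → Fin c) :
    (⊤ : SimpleGraph (Fin m)).edgeSet → Bool :=
  fun e => !decide (IsLive V e ∧ ((e : Sym2 (Fin m)).map h).IsDiag)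

/-- `colorTest` on a concrete edge. [folklore] -/
theorem colorTest_mk (V : Finset (Fin m)) {c : ℕ} (h : Fin m → Fin c) {u v : Fin m}
    (he : s(u, v) ∈ (⊤ : SimpleGraph (Fin m)).edgeSet) :
    colorTest V h ⟨s(u, v), he⟩ = !decide ((u ∈ V ∧ v ∈ V) ∧ h u = h v) := by
  simp [colorTest, IsLive]

/-- `colorTest` is off exactly on live monochromatic edges. [folklore] -/
theorem colorTest_mk_eq_false_iff (V : Finset (Fin m)) {c : ℕ} (h : Fin m → Fin c) {u v : Fin m}
    (he : s(u, v) ∈ (⊤ : SimpleGraph (Fin m)).edgeSet) :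
    colorTest V h ⟨s(u, v), he⟩ = false ↔ (u ∈ V ∧ v ∈ V) ∧ h u = h v := by
  rw [colorTest_mk, Bool.not_eq_false', decide_eq_true_eq]

/-- `cliqueVec` on a concrete edge. [folklore] -/
theorem cliqueVec_mk (Q : Finset (Fin m)) {u v : Fin m} (he : s(u, v) ∈ (⊤ : SimpleGraph (Fin m)).edgeSet) :
    cliqueVec Q ⟨s(u, v), he⟩ = decide (u ∈ Q ∧ v ∈ Q) := by
  simp [cliqueVec]

/-- `cliqueVec Q e = true` iff `e` is live for `Q`. [folklore] -/
theorem cliqueVec_eq_true_iff (Q : Finset (Fin m)) (e : (⊤ : SimpleGraph (Fin m)).edgeSet) :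
    cliqueVec Q e = true ↔ IsLive Q e := by
  simp [cliqueVec, IsLive]

/-- On the whole vertex set the coclique test input is the colouring vector of
`CliqueTestGraphs`. [folklore] -/
theorem colorTest_univ {c : ℕ} (h : Fin m → Fin c) : colorTest (univ : Finset (Fin m)) h = colorVec h := by
  funext e
  simp [colorTest, colorVec, IsLive]

/-- Recolouring along an injection does not change the coclique. [folklore] -/
theorem colorTest_comp {V : Finset (Fin m)} {c c' : ℕ} (ι : Fin c → Fin c')
    (hι : Function.Injective ι) (h : Fin m → Fin c) : colorTest V (ι ∘ h) = colorTest V h := by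
  funext e
  induction e using edge_ind with
  | _ u v huv => simp [colorTest_mk, hι.eq_iff]

/-- Bigger vertex sets have bigger clique vectors. [folklore] -/
theorem cliqueVec_mono {Q Q' : Finset (Fin m)} (hQ : Q' ⊆ Q) : cliqueVec Q' ≤ cliqueVec (m := m) Q := by
  intro e
  rw [Bool.le_iff_imp, cliqueVec_eq_true_iff, cliqueVec_eq_true_iff]
  exact fun h => h.mono hQ

/-- Selecting live edges of a clique inside the live set from the all-zero pattern gives the
clique back. [folklore] -/
theorem select_bot_cliqueVec {V Q : Finset (Fin m)} (hQV : Q ⊆ V) :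
    select V (fun _ => false) (cliqueVec Q) = cliqueVec Q := by
  funext e
  by_cases he : IsLive V e
  · exact select_of_isLive he
  · rw [select_of_not_isLive he]
    symm
    rw [Bool.eq_false_iff]
    intro h
    exact he ((cliqueVec_eq_true_iff Q e).1 h |>.mono hQV)

/-- Any selection of a clique inside the live set dominates the clique. [folklore] -/
theorem cliqueVec_le_select {V Q : Finset (Fin m)} (hQV : Q ⊆ V)
    (π : (⊤ : SimpleGraph (Fin m)).edgeSet → Bool) : cliqueVec Q ≤ select V π (cliqueVec Q) := by
  intro e
  by_cases he : IsLive V e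
  · rw [select_of_isLive he]
  · rw [Bool.le_iff_imp]
    intro h
    exact absurd (((cliqueVec_eq_true_iff Q e).1 h).mono hQV) he

/-- Selecting from the all-zero pattern stays below the clique vector of the live set.
[folklore] -/
theorem select_bot_le_cliqueVec (Q : Finset (Fin m)) (x : (⊤ : SimpleGraph (Fin m)).edgeSet → Bool) :
    select Q (fun _ => false) x ≤ cliqueVec Q := by
  intro e
  by_cases he : IsLive Q e
  · rw [(cliqueVec_eq_true_iff Q e).2 he]
    exact le_top
  · rw [select_of_not_isLive he]
    exact bot_le

/-- Selecting a smaller coclique test from the all-zero pattern stays below the bigger one.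
[folklore] -/
theorem select_bot_colorTest_le (V Q : Finset (Fin m)) {a : ℕ} (h : Fin m → Fin a) :
    select Q (fun _ => false) (colorTest Q h) ≤ colorTest V h := by
  intro e
  by_cases he : IsLive Q e
  · rw [select_of_isLive he]
    induction e using edge_ind with
    | _ u v huv =>
      refine bool_le_of_eq_false fun hR => ?_
      rw [colorTest_mk_eq_false_iff] at hR ⊢
      exact ⟨(isLive_mk _).1 he, hR.2⟩
  · rw [select_of_not_isLive he]
    exact Bool.false_le _

/-- The coclique pattern below a selection on a monochromatic live set: if `W ⊆ V` is
monochromatic for `h`, the coclique of `h` has no live edge for `W`, so it lies below every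
selection from it. [folklore] -/
theorem colorTest_le_select {V W : Finset (Fin m)} (hWV : W ⊆ V) {c : ℕ} {h : Fin m → Fin c}
    {k : Fin c} (hW : ∀ v ∈ W, h v = k) (x : (⊤ : SimpleGraph (Fin m)).edgeSet → Bool) :
    colorTest V h ≤ select W (colorTest V h) x := by
  intro e
  by_cases he : IsLive W e
  · rw [select_of_isLive he]
    induction e using edge_ind with
    | _ u v huv =>
      obtain ⟨hu, hv⟩ := (isLive_mk _).1 he
      have h0 : colorTest V h ⟨s(u, v), (SimpleGraph.mem_edgeSet _).2 huv⟩ = false :=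
        (colorTest_mk_eq_false_iff V h _).2 ⟨⟨hWV hu, hWV hv⟩, (hW u hu).trans (hW v hv).symm⟩
      rw [h0]
      exact Bool.false_le _
  · rw [select_of_not_isLive he]

/-- **Extending colourings across a colour restriction.** Let `W ⊆ V` and `a' + c ≤ a`. For a
colouring `h' : Fin m → Fin a'` of the new live set and the old colouring `h : Fin m → Fin c`,
colour `W` by `h'` (colours `< a'`) and the rest by `h` shifted by `a'`; the resulting
`a`-coclique on `V` dominates the selection of the `a'`-coclique on `W` from the pattern
`colorTest V h`. [folklore] -/
theorem select_colorTest_le (V W : Finset (Fin m)) {a a' c : ℕ} (hac : a' + c ≤ a)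
    (h : Fin m → Fin c) (h' : Fin m → Fin a') :
    select W (colorTest V h) (colorTest W h') ≤
      colorTest V (fun v => if v ∈ W then (⟨(h' v).val, by have := (h' v).isLt; omega⟩ : Fin a)
        else ⟨a' + (h v).val, by have := (h v).isLt; omega⟩) := by
  intro e
  induction e using edge_ind with
  | _ u v huv =>
    refine bool_le_of_eq_false fun hR => ?_
    obtain ⟨⟨hu, hv⟩, heq⟩ := (colorTest_mk_eq_false_iff V _ _).1 hR
    by_cases he : IsLive W ⟨s(u, v), (SimpleGraph.mem_edgeSet _).2 huv⟩
    · obtain ⟨huW, hvW⟩ := (isLive_mk _).1 he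
      rw [select_of_isLive he, colorTest_mk_eq_false_iff]
      refine ⟨⟨huW, hvW⟩, Fin.ext ?_⟩
      simp only [huW, hvW, ↓reduceIte, Fin.mk.injEq] at heq
      exact heq
    · rw [select_of_not_isLive he, colorTest_mk_eq_false_iff]
      refine ⟨⟨hu, hv⟩, ?_⟩
      rw [isLive_mk] at he
      by_cases huW : u ∈ W <;> by_cases hvW : v ∈ W
      · exact absurd ⟨huW, hvW⟩ he
      · simp only [huW, hvW, ↓reduceIte, Fin.mk.injEq] at heq
        have := (h' u).isLt
        omega
      · simp only [huW, hvW, ↓reduceIte, Fin.mk.injEq] at heq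
        have := (h' v).isLt
        omega
      · simp only [huW, hvW, ↓reduceIte, Fin.mk.injEq] at heq
        exact Fin.ext (by omega)

/-! ### Clique-like functions relative to a live set (Jukna 2012, §9.8) -/

/-- **`(a, b)`-clique functions** (Jukna 2012, §9.8, p. 269) relative to a live vertex set `V`:
`F` is monotone, rejects the coclique test input of every colouring with `a` colours, and
accepts the clique vector of every `b`-subset of `V`. (For `V = univ`, `CLIQUE(m, s)` is an
`(s-1, s)`-clique function, `cliqueLike_cliqueFn`.) [cite: Jukna2012, §9.8] -/
structure CliqueLike (V : Finset (Fin m)) (a b : ℕ)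
    (F : ((⊤ : SimpleGraph (Fin m)).edgeSet → Bool) → Bool) : Prop where
  /-- `F` is monotone -/
  mono : Monotone F
  /-- `F` rejects all `a`-cocliques on `V` -/
  rejects : ∀ h : Fin m → Fin a, F (colorTest V h) = false
  /-- `F` accepts all `b`-cliques inside `V` -/
  accepts : ∀ Q ⊆ V, #Q = b → F (cliqueVec Q) = true

/-- `CLIQUE(m, s)` is an `(s-1, s)`-clique function on the whole vertex set (Jukna 2012, §9.8:
"CLIQUE(n, k) is an (a, b)-clique function with a = k - 1 and b = k"), for `s ≥ 1`.
[cite: Jukna2012, §9.8] -/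
theorem cliqueLike_cliqueFn {s : ℕ} (hs : 1 ≤ s) :
    CliqueLike (univ : Finset (Fin m)) (s - 1) s (cliqueFn m s) where
  mono := cliqueFn_monotone_holds m s
  rejects h := by rw [colorTest_univ]; exact cliqueFn_colorVec h (by omega)
  accepts Q _ hQ := cliqueFn_cliqueVec hQ.ge

namespace CliqueLike

variable {V : Finset (Fin m)} {a b : ℕ} {F : ((⊤ : SimpleGraph (Fin m)).edgeSet → Bool) → Bool}

/-- Fewer colours are rejected as well. [folklore] -/
theorem rejects_of_le (hF : CliqueLike V a b F) {c : ℕ} (hca : c ≤ a) (h : Fin m → Fin c) :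
    F (colorTest V h) = false := by
  rw [← colorTest_comp (Fin.castLE hca) (Fin.castLE_injective hca) h]
  exact hF.rejects _

/-- Bigger cliques inside `V` are accepted as well. [folklore] -/
theorem accepts_of_le (hF : CliqueLike V a b F) {Q : Finset (Fin m)} (hQV : Q ⊆ V) (hbQ : b ≤ #Q) :
    F (cliqueVec Q) = true := by
  obtain ⟨Q', hQ'Q, hQ'⟩ := Finset.exists_subset_card_eq hbQ
  have h1 := hF.accepts Q' (hQ'Q.trans hQV) hQ'
  have h2 := hF.mono (cliqueVec_mono hQ'Q)
  rw [h1] at h2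
  exact top_le_iff.1 h2

/-- **Colour restriction** (type 1): restricting an `(a, b)`-clique function on `V` to a
subset `W ⊆ V`, with the dead edges frozen to the coclique of a colouring `h` with `c`
colours, gives an `(a - c, b)`-clique function on `W`. [folklore] -/
theorem restrictColor (hF : CliqueLike V a b F) {W : Finset (Fin m)} (hWV : W ⊆ V) {c : ℕ}
    (hca : c ≤ a) (h : Fin m → Fin c) :
    CliqueLike W (a - c) b (fun x => F (select W (colorTest V h) x)) where
  mono := hF.mono.comp (select_mono W _)
  rejects h' := by
    have hle := hF.mono (select_colorTest_le V W (a := a) (a' := a - c) (by omega) h h')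
    rw [hF.rejects] at hle
    exact le_bot_iff.1 hle
  accepts Q hQW hQ := by
    have hle := hF.mono (cliqueVec_le_select hQW (colorTest V h))
    rw [hF.accepts Q (hQW.trans hWV) hQ] at hle
    exact top_le_iff.1 hle

/-- **Clique restriction** (type 0): restricting an `(a, b)`-clique function on `V` to
`Q ⊆ V` with all dead edges frozen to `0` gives an `(a, b)`-clique function on `Q`.
[folklore] -/
theorem restrictClique (hF : CliqueLike V a b F) {Q : Finset (Fin m)} (hQV : Q ⊆ V) :
    CliqueLike Q a b (fun x => F (select Q (fun _ => false) x)) where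
  mono := hF.mono.comp (select_mono Q _)
  rejects h' := by
    have hle := hF.mono (select_bot_colorTest_le V Q h')
    rw [hF.rejects] at hle
    exact le_bot_iff.1 hle
  accepts Q' hQ'Q hQ' := by
    show F (select Q (fun _ => false) (cliqueVec Q')) = true
    rw [select_bot_cliqueVec hQ'Q]
    exact hF.accepts Q' (hQ'Q.trans hQV) hQ'

end CliqueLike

/-! ### Killing a monotone function by a restriction (Jukna 2012, §10.5) -/

/-- If a monotone `g` accepts the coclique of `h` on `V`, then after restricting to a set `W`
that is monochromatic for `h` (pattern = that coclique) `g` is the constant `1`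
(Jukna 2012, §10.5, proof of Claim 10.22). [cite: Jukna2012, §10.5] -/
theorem apply_select_colorTest_eq_true {g : ((⊤ : SimpleGraph (Fin m)).edgeSet → Bool) → Bool}
    (hg : Monotone g) {V W : Finset (Fin m)} (hWV : W ⊆ V) {c : ℕ} {h : Fin m → Fin c} {k : Fin c}
    (hW : ∀ v ∈ W, h v = k) (h1 : g (colorTest V h) = true)
    (x : (⊤ : SimpleGraph (Fin m)).edgeSet → Bool) : g (select W (colorTest V h) x) = true := by
  have := hg (colorTest_le_select hWV hW x)
  rw [h1] at this
  exact top_le_iff.1 this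

/-- If a monotone `g` rejects the clique on `Q`, then after restricting to `Q` with all dead
edges `0`, `g` is the constant `0` (Jukna 2012, §10.5, proof of Claim 10.22).
[cite: Jukna2012, §10.5] -/
theorem apply_select_bot_eq_false {g : ((⊤ : SimpleGraph (Fin m)).edgeSet → Bool) → Bool}
    (hg : Monotone g) {Q : Finset (Fin m)} (h0 : g (cliqueVec Q) = false)
    (x : (⊤ : SimpleGraph (Fin m)).edgeSet → Bool) : g (select Q (fun _ => false) x) = false := by
  have := hg (select_bot_le_cliqueVec Q x)
  rw [h0] at this
  exact le_bot_iff.1 this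

/-! ### Restricting straight-line programs -/

namespace GateList

variable {ι : Type*}

/-- Relocation preserves the NOT count. [folklore] -/
@[simp] theorem negs_map_reloc {ι' : Type*} (ρ : ι' → ι ⊕ ℕ) (L : ℕ) (gs : List (Gate ι')) :
    negs (gs.map (reloc ρ L)) = negs gs := by
  simp [negs, List.map_map, Function.comp_def]

/-- Wires of a program over `{∧₂, ∨₂, 0, 1}` carry monotone functions (constants are monotone;
otherwise `const_or_exists_monotone_circuit` and `Circuit.monotone_eval_of_isOver_monotoneBasis`).
[folklore] -/
theorem monotone_wireOf_vals01 (ms : List (Gate ι)) (hwf : WF ms)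
    (hB : ∀ g ∈ ms, g.fn ∈ monotoneBasis01) (o : ι ⊕ ℕ) (ho : OutOK ms.length o) :
    Monotone fun x => wireOf x (vals ms x) o := by
  rcases const_or_exists_monotone_circuit ms o hwf hB ho with ⟨b, hb⟩ | ⟨C, hC, -, hev⟩
  · intro x y _
    simp only [hb]
    exact le_rfl
  · intro x y hxy
    simp only [← hev]
    exact C.monotone_eval_of_isOver_monotoneBasis hC hxy

variable (V : Finset (Fin m)) (π : (⊤ : SimpleGraph (Fin m)).edgeSet → Bool)

/-- The input wires of the restricted program: a live edge stays an input, a dead edge reads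
the constant gate `0` or `1` prescribed by the pattern. [folklore] -/
def restrictWire : (⊤ : SimpleGraph (Fin m)).edgeSet → (⊤ : SimpleGraph (Fin m)).edgeSet ⊕ ℕ :=
  fun e => if IsLive V e then .inl e else .inr (if π e then 1 else 0)

/-- The two constant gates `0` (position `0`) and `1` (position `1`). [folklore] -/
def constPrefix : List (Gate (⊤ : SimpleGraph (Fin m)).edgeSet) :=
  [constGate _ false, constGate _ true]

/-- **The restricted program**: the constants `0, 1` followed by the original program with
dead inputs rewired to them (Jukna 2012, §10.5: "assign the constant … to all the variables in
`Y`"). [cite: Jukna2012, §10.5] -/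
def restrictGates (gs : List (Gate (⊤ : SimpleGraph (Fin m)).edgeSet)) :
    List (Gate (⊤ : SimpleGraph (Fin m)).edgeSet) :=
  constPrefix ++ gs.map (reloc (restrictWire V π) 2)

/-- The values of the two constant gates. [folklore] -/
@[simp] theorem vals_constPrefix (x : (⊤ : SimpleGraph (Fin m)).edgeSet → Bool) :
    vals (constPrefix (m := m)) x = [false, true] := rfl

/-- The constant prefix has two gates. [folklore] -/
@[simp] theorem length_constPrefix : (constPrefix (m := m)).length = 2 := rfl

/-- The restricted input wires only read the two constant gates. [folklore] -/
theorem wiresOK_restrictWire : WiresOK 2 (restrictWire V π) := by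
  intro e n h
  unfold restrictWire at h
  split at h
  · cases h
  · split at h <;> cases h <;> omega

/-- Reading the restricted input wires off the constant gates is `select`. [folklore] -/
theorem wireOf_restrictWire (x : (⊤ : SimpleGraph (Fin m)).edgeSet → Bool) :
    (fun e => wireOf x [false, true] (restrictWire V π e)) = select V π x := by
  funext e
  unfold restrictWire select
  by_cases he : IsLive V e
  · simp [he]
  · simp only [he, ↓reduceIte]
    cases π e <;> rfl

/-- The constant prefix is well formed. [folklore] -/
theorem wf_constPrefix : WF (constPrefix (m := m)) :=
  (WF.singleton (gateOK_constGate 0 false)).append_singleton (gateOK_constGate 1 true)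

/-- **Values of the restricted program**: the constants, then the original values on the
selected input. [folklore] -/
theorem vals_restrictGates (gs : List (Gate (⊤ : SimpleGraph (Fin m)).edgeSet))
    (x : (⊤ : SimpleGraph (Fin m)).edgeSet → Bool) :
    vals (restrictGates V π gs) x = [false, true] ++ vals gs (select V π x) := by
  have h := vals_append_reloc constPrefix gs (restrictWire V π) (wiresOK_restrictWire V π) x
  simp only [length_constPrefix, vals_constPrefix] at h
  rw [wireOf_restrictWire] at h
  exact h

/-- A relocated wire of the restricted program carries the original wire on the selected
input. [folklore] -/
theorem wireOf_restrictGates (gs : List (Gate (⊤ : SimpleGraph (Fin m)).edgeSet))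
    (x : (⊤ : SimpleGraph (Fin m)).edgeSet → Bool) (w : (⊤ : SimpleGraph (Fin m)).edgeSet ⊕ ℕ) :
    wireOf x (vals (restrictGates V π gs) x) (shiftWire (restrictWire V π) 2 w) =
      wireOf (select V π x) (vals gs (select V π x)) w := by
  rw [vals_restrictGates, wireOf_shiftWire x [false, true] (vals gs (select V π x)) (L := 2) rfl
    (restrictWire V π) (wiresOK_restrictWire V π) w, wireOf_restrictWire]

/-- The restricted program is well formed. [folklore] -/
theorem wf_restrictGates {gs : List (Gate (⊤ : SimpleGraph (Fin m)).edgeSet)} (hwf : WF gs) :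
    WF (restrictGates V π gs) :=
  wf_constPrefix.append_reloc hwf (wiresOK_restrictWire V π)

/-- The restricted program is over `{∧₂, ∨₂, ¬, 0, 1}` if the original is. [folklore] -/
theorem isOver_restrictGates {gs : List (Gate (⊤ : SimpleGraph (Fin m)).edgeSet)}
    (hB : ∀ g ∈ gs, g.fn ∈ deMorganBasis01) : ∀ g ∈ restrictGates V π gs, g.fn ∈ deMorganBasis01 := by
  intro g hg
  simp only [restrictGates, constPrefix, List.cons_append, List.nil_append, List.mem_cons,
    List.mem_map] at hg
  rcases hg with rfl | rfl | ⟨g', hg', rfl⟩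
  · exact const_mem_deMorganBasis01 false
  · exact const_mem_deMorganBasis01 true
  · rw [reloc_fn]; exact hB g' hg'

/-- Restriction keeps the NOT count. [folklore] -/
@[simp] theorem negs_restrictGates (gs : List (Gate (⊤ : SimpleGraph (Fin m)).edgeSet)) :
    negs (restrictGates V π gs) = negs gs := by
  simp [restrictGates, constPrefix]

/-- Restriction adds two gates. [folklore] -/
@[simp] theorem length_restrictGates (gs : List (Gate (⊤ : SimpleGraph (Fin m)).edgeSet)) :
    (restrictGates V π gs).length = gs.length + 2 := by
  simp [restrictGates, Nat.add_comm]

/-- Shifted output wires are valid for the restricted program. [folklore] -/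
theorem outOK_shiftWire {L : ℕ} {o : (⊤ : SimpleGraph (Fin m)).edgeSet ⊕ ℕ} (ho : OutOK L o) :
    OutOK (L + 2) (shiftWire (restrictWire V π) 2 o) := by
  intro n hn
  rcases o with e | k
  · simp only [shiftWire] at hn
    have := wiresOK_restrictWire V π e n hn
    omega
  · simp only [shiftWire, Sum.inr.injEq] at hn
    have := ho k rfl
    omega

/-- Relocating a NOT gate gives the NOT gate on the shifted wire. [folklore] -/
theorem reloc_notGate (w : (⊤ : SimpleGraph (Fin m)).edgeSet ⊕ ℕ) :
    reloc (restrictWire V π) 2 (notGate w) = notGate (shiftWire (restrictWire V π) 2 w) := rfl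

/-- **Killing the first NOT gate.** Let `pre ++ ¬w :: post` be a well-formed program over
`{∧₂, ∨₂, ¬, 0, 1}` whose output wire `o` computes `F`, and suppose that after the restriction
`(V, π)` the wire `w` of `pre` is the constant `ε`. Then restricting the program and freezing the
NOT gate to the constant `¬ε` yields a well-formed program over the same basis with two more
gates and one NOT gate fewer whose (shifted) output computes `F ∘ select V π`
(Jukna 2012, §10.5, proof of Claim 10.22: "the subsequent NOT gate can be eliminated").
[cite: Jukna2012, §10.5] -/
theorem killFirstNot (pre post : List (Gate (⊤ : SimpleGraph (Fin m)).edgeSet))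
    (w o : (⊤ : SimpleGraph (Fin m)).edgeSet ⊕ ℕ)
    (F : ((⊤ : SimpleGraph (Fin m)).edgeSet → Bool) → Bool) (ε : Bool)
    (hwf : WF (pre ++ notGate w :: post))
    (hB : ∀ g ∈ pre ++ notGate w :: post, g.fn ∈ deMorganBasis01)
    (ho : OutOK (pre ++ notGate w :: post).length o)
    (hF : ∀ x, wireOf x (vals (pre ++ notGate w :: post) x) o = F x)
    (hconst : ∀ x, wireOf (select V π x) (vals pre (select V π x)) w = ε) :
    ∃ (gs' : List (Gate (⊤ : SimpleGraph (Fin m)).edgeSet)) (o' : (⊤ : SimpleGraph (Fin m)).edgeSet ⊕ ℕ),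
      WF gs' ∧ (∀ g ∈ gs', g.fn ∈ deMorganBasis01) ∧
      gs'.length = (pre ++ notGate w :: post).length + 2 ∧
      negs gs' + 1 = negs (pre ++ notGate w :: post) ∧ OutOK gs'.length o' ∧
      ∀ x, wireOf x (vals gs' x) o' = F (select V π x) := by
  set ρ := restrictWire V π with hρ
  set pre' := constPrefix ++ pre.map (reloc ρ 2) with hpre'
  set post' := post.map (reloc ρ 2) with hpost'
  set w' := shiftWire ρ 2 w with hw'
  have hshape : restrictGates V π (pre ++ notGate w :: post) = pre' ++ notGate w' :: post' := by
    simp [restrictGates, hpre', hpost', hw', hρ, reloc_notGate]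
  have hpre'r : pre' = restrictGates V π pre := rfl
  -- the frozen program
  refine ⟨pre' ++ constGate _ (!ε) :: post', shiftWire ρ 2 o, ?_, ?_, ?_, ?_, ?_, ?_⟩
  · have h1 : WF (pre' ++ notGate w' :: post') := hshape ▸ wf_restrictGates V π hwf
    exact h1.replace (gateOK_constGate _ _)
  · have h1 : ∀ g ∈ pre' ++ notGate w' :: post', g.fn ∈ deMorganBasis01 :=
      hshape ▸ isOver_restrictGates V π hB
    intro g hg
    simp only [List.mem_append, List.mem_cons] at hg
    rcases hg with hg | rfl | hg
    · exact h1 g (by simp [hg])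
    · simpa using const_mem_deMorganBasis01 (!ε)
    · exact h1 g (by simp [hg])
  · have h1 := length_restrictGates V π (pre ++ notGate w :: post)
    rw [hshape] at h1
    simp only [List.length_append, List.length_cons] at h1 ⊢
    omega
  · have h1 := negs_restrictGates V π (pre ++ notGate w :: post)
    rw [hshape] at h1
    simp only [negs_append, negs_cons, notGate_fn, negWeight_not, constGate_fn, negWeight_const] at h1 ⊢
    omega
  · have h1 : (pre' ++ constGate _ (!ε) :: post').length = (pre ++ notGate w :: post).length + 2 := by
      have h2 := length_restrictGates V π (pre ++ notGate w :: post)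
      rw [hshape] at h2
      simp only [List.length_append, List.length_cons] at h2 ⊢
      omega
    rw [h1]
    exact outOK_shiftWire V π ho
  · intro x
    -- freezing the NOT gate does not change any value
    have hvals : vals (pre' ++ constGate _ (!ε) :: post') x = vals (pre' ++ notGate w' :: post') x := by
      refine (vals_replace_eq pre' post' (notGate w') (constGate _ (!ε)) x ?_).symm
      show (!(wireOf x (vals pre' x) w')) = !ε
      rw [hpre'r, hw', hρ, wireOf_restrictGates V π pre x w, hconst x]
    rw [hvals, ← hshape, wireOf_restrictGates V π _ x o, hF]

end GateList

end Literature.Computability.Complexity
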